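import Summits.AtomisticToContinuum.Crystallization.Theorems.FrustratedLawDichotomyKissingRigidityShape

/-!
# FrustratedLawDichotomy · crux `AperiodicFrustratedLawGap` (stmt-AtomisticToContinuum-27623) — THE TWO-SHELL KISSING-RIGIDITY DOOR
# `ChargedEnergyGap (14231) ∧ KR2_shape ⟹ FDG ⟹ crux / registered stub / D 26654` (decomp-a2c, prover hand 2, gen 8; critic row 401 (3))

The single-shell statements `KR`, `KR_shape`, `KR_shape12` (hypotheses of p816068 / p816649 / p816717) are FALSE (`FrustratedLawDichotomyTwistedDozen`,
`FrustratedLawDichotomyTwistedDozenChargeFree`: the jitterbug flex of the kissing dozen moves contacts to second order only).  The critic's repair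
C′ = R2a (row 401 (3)–(4), lens-5 28b memo §3) asks for the TWO-SHELL form: rigidity is demanded only at sites whose twelve bonded neighbours are
THEMSELVES charge-free (the capped `18/19`-point framework is first-order rigid — lens-5 MEASURED 28b: rank `51/51`, `σ_min ≈ 0.744`).  This file
TYPES that statement in the tree's vocabulary, with the registered literals `θ = 1/100` (the tolerance of item 14231) and `η < 1/20` (the crux's
goodness), and proves the door with an explicit loss factor `30`:

* `KR2_shape` (hypothesis `h2`, inline, def-free) : `KR_shape`'s text with ONE extra hypothesis — every `1/100`-bonded neighbour `j` of the charge-free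
  site `i` is charge-free(1/100) too; conclusion unchanged (the bonded dozen, bijectively indexed by the fcc or hcp pattern, lies within `η·nn_i`,
  `η < 1/20`, of `nn_i·A(pattern)`).
* `robustGood_of_twoShell` : `KR2_shape ⟹` every two-shell charge-free site is robustly good in `range y` (p816649's `robustGood_of_shape` + KR_gap).
* `card_adj_le` : in a `7/10`-separated configuration every site has at most `29` neighbours in the `1/100`-bond graph (they lie within `1.01·nn_j`
  and are pairwise `≥ nn_j/1.01` apart; volume packing `card_le_of_separated_of_dist_le`: `(2·1.01² + 1)³ < 29`).
* `card_le_good_add` : `N ≤ #good + 30·#charged` whenever two-shell charge-free sites are good (a site failing two-shell charge-freeness is charged or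
  a bond-neighbour of a charged site).
* `frustrationDensityGap_of_chargedEnergyGap_of_kr2Shape` : `ChargedEnergyGap → KR2_shape → FDG` with `κ' = C = κ/30`;
  `aperiodicFrustratedLawGap_…` (crux BY NAME, given `MuEquilibriumDoor` — closed by p816834 in a module this file cannot co-import, see g7 memo),
  `aperiodicErgodicGap_…` (REGISTERED STUB verbatim), `noFrustratedPeriodicMinimiser_…` (item 26654, door-free).
What stays open beneath this door: `KR2_shape` itself = LOCAL (capped-framework rigidity certificate, lens-5 g29) ∧ GLOBAL BASIN (every two-shell
charge-free(1/100) arrangement lies in the basin of capped fcc/hcp — IDEA-NEEDED, census TAG 146 (c′)).  `[folklore]` bookkeeping; no `sorry`.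
-/

noncomputable section

namespace Summit.AtomisticToContinuum.Crystallization.Theorems.FrustratedLawDichotomyTwoShellRigidityDoor

open Literature.Geometry.DiscreteGeometry
open Literature.MathematicalPhysics.StatisticalMechanics
open Summit.AtomisticToContinuum.Crystallization.Theses.PricedLinkCensus (ChargedEnergyGap)
open Summit.AtomisticToContinuum.Crystallization.Theorems.ChargedEnergyGapNegative (E3 eStar charged chargedEnergyGap_iff_price)
open Summit.AtomisticToContinuum.Crystallization.Theorems.FrustratedLawDichotomyThirteenthNeighbourGap (thirteenth_neighbour_gap_fcc)
open Summit.AtomisticToContinuum.Crystallization.Theorems.FrustratedLawDichotomyThirteenthNeighbourGapHcp (thirteenth_neighbour_gap_hcp)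
open Summit.AtomisticToContinuum.Crystallization.Theorems.FrustratedLawDichotomyKissingRigidityShape (robustGood_of_shape)
open Summit.AtomisticToContinuum.Crystallization.Theorems.FrustratedLawDichotomyFrustrationDensityGapDoor
  (aperiodicFrustratedLawGap_of_frustrationDensityGap aperiodicErgodicGap_of_frustrationDensityGap)
open Summit.AtomisticToContinuum.Crystallization.Theorems.FrustratedLawDichotomyLocalCloseOrderPeriodic
  (noFrustratedPeriodicMinimiser_of_frustrationDensityGap)

/-- **`KR2_shape ⟹` two-shell charge-free sites are robustly good** (data `d = nn_i`, `γ = nn_i/100`, `t = y ∘ τ`; KR_gap supplies the clean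
`13/10`-gap). [folklore] -/
theorem robustGood_of_twoShell
    (h2 : ∀ (N : ℕ) (y : Fin N → EuclideanSpace ℝ (Fin 3)), Function.Injective y → (∀ a b : Fin N, a ≠ b → (7 : ℝ) / 10 ≤ dist (y a) (y b)) → ∀ i : Fin N, Literature.Geometry.DiscreteGeometry.IsChargeFree (1 / 100 : ℝ) y i → (∀ j : Fin N, (Literature.Geometry.DiscreteGeometry.bondGraph (1 / 100 : ℝ) y).Adj i j → Literature.Geometry.DiscreteGeometry.IsChargeFree (1 / 100 : ℝ) y j) → ∃ (η : ℝ) (A : EuclideanSpace ℝ (Fin 3) →ₗᵢ[ℝ] EuclideanSpace ℝ (Fin 3)), η < 1 / 20 ∧ ((∃ τ : ↥Literature.Geometry.DiscreteGeometry.fccKissingPattern → Fin N, (∀ u : ↥Literature.Geometry.DiscreteGeometry.fccKissingPattern, (Literature.Geometry.DiscreteGeometry.bondGraph (1 / 100 : ℝ) y).Adj i (τ u)) ∧ (∀ k : Fin N, (Literature.Geometry.DiscreteGeometry.bondGraph (1 / 100 : ℝ) y).Adj i k → ∃ u : ↥Literature.Geometry.DiscreteGeometry.fccKissingPattern, τ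 u = k) ∧ (∀ u : ↥Literature.Geometry.DiscreteGeometry.fccKissingPattern, ‖(y (τ u) - y i) - Literature.Geometry.DiscreteGeometry.nearestDist y i • A (u : EuclideanSpace ℝ (Fin 3))‖ ≤ η * Literature.Geometry.DiscreteGeometry.nearestDist y i)) ∨ (∃ τ : ↥Literature.Geometry.DiscreteGeometry.hcpKissingPattern → Fin N, (∀ u : ↥Literature.Geometry.DiscreteGeometry.hcpKissingPattern, (Literature.Geometry.DiscreteGeometry.bondGraph (1 / 100 : ℝ) y).Adj i (τ u)) ∧ (∀ k : Fin N, (Literature.Geometry.DiscreteGeometry.bondGraph (1 / 100 : ℝ) y).Adj i k → ∃ u : ↥Literature.Geometry.DiscreteGeometry.hcpKissingPattern, τ u = k) ∧ (∀ u : ↥Literature.Geometry.DiscreteGeometry.hcpKissingPattern, ‖(y (τ u) - y i) - Literature.Geometry.DiscreteGeometry.nearestDist y i • A (u : EuclideanSpace ℝ (Fin 3))‖ ≤ η * Literature.Geometry.DiscreteGeometry.nearestDist y i)))) :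
    ∀ (N : ℕ) (y : Fin N → EuclideanSpace ℝ (Fin 3)), Function.Injective y → (∀ a b : Fin N, a ≠ b → (7 : ℝ) / 10 ≤ dist (y a) (y b)) →
      ∀ i : Fin N, Literature.Geometry.DiscreteGeometry.IsChargeFree (1 / 100 : ℝ) y i →
        (∀ j : Fin N, (Literature.Geometry.DiscreteGeometry.bondGraph (1 / 100 : ℝ) y).Adj i j → Literature.Geometry.DiscreteGeometry.IsChargeFree (1 / 100 : ℝ) y j) →
        ∃ (d η γ : ℝ) (A : EuclideanSpace ℝ (Fin 3) →ₗᵢ[ℝ] EuclideanSpace ℝ (Fin 3)), (∃ t : ↥Literature.Geometry.DiscreteGeometry.fccKissingPattern → EuclideanSpace ℝ (Fin 3), 0 < d ∧ 0 < γ ∧ η < 1 / 20 ∧ (∀ u : ↥Literature.Geometry.DiscreteGeometry.fccKissingPattern, t u ∈ (Set.range y) ∧ ‖(t u - (y i)) - d • A (u : EuclideanSpace ℝ (Fin 3))‖ ≤ η * d) ∧ (∀ s : EuclideanSpace ℝ (Fin 3), s ∈ (Set.range y) → s ≠ (y i) → d ≤ dist s (y i)) ∧ (∃ s : EuclideanSpace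 ℝ (Fin 3), s ∈ (Set.range y) ∧ s ≠ (y i) ∧ dist s (y i) ≤ d) ∧ (∀ s : EuclideanSpace ℝ (Fin 3), s ∈ (Set.range y) → s ≠ (y i) → dist s (y i) < 13 / 10 * d + γ → dist s (y i) ≤ 13 / 10 * d - γ ∧ s ∈ Set.range t)) ∨ (∃ t : ↥Literature.Geometry.DiscreteGeometry.hcpKissingPattern → EuclideanSpace ℝ (Fin 3), 0 < d ∧ 0 < γ ∧ η < 1 / 20 ∧ (∀ u : ↥Literature.Geometry.DiscreteGeometry.hcpKissingPattern, t u ∈ (Set.range y) ∧ ‖(t u - (y i)) - d • A (u : EuclideanSpace ℝ (Fin 3))‖ ≤ η * d) ∧ (∀ s : EuclideanSpace ℝ (Fin 3), s ∈ (Set.range y) → s ≠ (y i) → d ≤ dist s (y i)) ∧ (∃ s : EuclideanSpace ℝ (Fin 3), s ∈ (Set.range y) ∧ s ≠ (y i) ∧ dist s (y i) ≤ d) ∧ (∀ s : EuclideanSpace ℝ (Fin 3), s ∈ (Set.range y) → s ≠ (y i) → dist s (y i) < 13 / 10 * d + γ → dist s (y i) ≤ 13 / 10 * d - γ ∧ s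 ∈ Set.range t)) := by
  intro N y hy hsep i hcf hcf2
  obtain ⟨η, A, hη, hcase⟩ := h2 N y hy hsep i hcf hcf2
  rcases hcase with ⟨τ, hτ₁, hτ₂, hfit⟩ | ⟨τ, hτ₁, hτ₂, hfit⟩
  · exact ⟨nearestDist y i, η, nearestDist y i / 100, A, Or.inl ⟨fun u => y (τ u),
      robustGood_of_shape hy hsep (fun hd hη ht h1 h2 => thirteenth_neighbour_gap_fcc hd hη ht h1 h2) hη hτ₁ hτ₂ hfit
        (Finset.card_pos.1 (by rw [card_fccKissingPattern]; norm_num))⟩⟩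
  · exact ⟨nearestDist y i, η, nearestDist y i / 100, A, Or.inr ⟨fun u => y (τ u),
      robustGood_of_shape hy hsep (fun hd hη ht h1 h2 => thirteenth_neighbour_gap_hcp hd hη ht h1 h2) hη hτ₁ hτ₂ hfit
        (Finset.card_pos.1 (by rw [card_hcpKissingPattern]; norm_num))⟩⟩

/-- **Bond degrees are bounded**: in a `7/10`-separated configuration every site `j` has at most `29` neighbours in the scale-free `1/100`-bond
graph — they lie in the closed ball of radius `1.01·nn_j` about `y j` and are pairwise `≥ nn_j/1.01` apart, and `(2·1.01² + 1)³ < 29`.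
[folklore] -/
theorem card_adj_le {N : ℕ} {y : Fin N → EuclideanSpace ℝ (Fin 3)} (hy : Function.Injective y)
    (hsep : ∀ a b : Fin N, a ≠ b → (7 : ℝ) / 10 ≤ dist (y a) (y b)) (j : Fin N) :
    (Nat.card {i : Fin N // (bondGraph (1 / 100 : ℝ) y).Adj i j} : ℝ) ≤ 29 := by
  classical
  rw [Nat.card_eq_fintype_card, Fintype.card_subtype]
  set S := Finset.univ.filter fun i : Fin N => (bondGraph (1 / 100 : ℝ) y).Adj i j with hS
  rcases S.eq_empty_or_nonempty with hS0 | ⟨i₀, hi₀⟩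
  · simp [hS0]
  have hi₀j : i₀ ≠ j := (bondGraph_adj.1 (Finset.mem_filter.1 hi₀).2).1
  -- the scale of `j`
  have hnn : (7 : ℝ) / 10 ≤ nearestDist y j := le_nearestDist ⟨i₀, hi₀j⟩ fun k hk => hsep j k (fun h => hk h.symm)
  have hnn0 : 0 < nearestDist y j := by linarith
  -- the neighbours as a point set
  set s : Finset (EuclideanSpace ℝ (Fin 3)) := S.image y with hs
  have hcard : s.card = S.card := Finset.card_image_of_injective S hy
  have hmem : ∀ c ∈ s, ∃ i, (bondGraph (1 / 100 : ℝ) y).Adj i j ∧ y i = c := by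
    intro c hc
    obtain ⟨i, hi, rfl⟩ := Finset.mem_image.1 hc
    exact ⟨i, (Finset.mem_filter.1 hi).2, rfl⟩
  -- every neighbour is within `1.01·nn_j` and has own scale `≥ nn_j/1.01`
  have hadj : ∀ i, (bondGraph (1 / 100 : ℝ) y).Adj i j →
      dist (y i) (y j) ≤ (101 / 100) * nearestDist y j ∧ nearestDist y j / (101 / 100) ≤ nearestDist y i := by
    intro i hi
    obtain ⟨hij, hle⟩ := bondGraph_adj.1 hi
    have h1 : dist (y i) (y j) ≤ (1 + 1 / 100) * nearestDist y j := hle.trans (mul_le_mul_of_nonneg_left (min_le_right _ _) (by norm_num))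
    have h2 : dist (y i) (y j) ≤ (1 + 1 / 100) * nearestDist y i := hle.trans (mul_le_mul_of_nonneg_left (min_le_left _ _) (by norm_num))
    have h3 : nearestDist y j ≤ dist (y i) (y j) := by rw [dist_comm]; exact nearestDist_le_dist y hij
    refine ⟨by linarith, ?_⟩
    rw [div_le_iff₀ (by norm_num : (0 : ℝ) < 101 / 100)]
    linarith
  have hR : ∀ c ∈ s, dist c (y j) ≤ (101 / 100) * nearestDist y j := by
    intro c hc
    obtain ⟨i, hi, rfl⟩ := hmem c hc
    exact (hadj i hi).1
  have hr : ∀ c ∈ s, ∀ d ∈ s, c ≠ d → nearestDist y j / (101 / 100) ≤ dist c d := by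
    intro c hc d hd hcd
    obtain ⟨i, hi, rfl⟩ := hmem c hc
    obtain ⟨i', hi', rfl⟩ := hmem d hd
    have hii' : i' ≠ i := fun h => hcd (by rw [h])
    exact (hadj i hi).2.trans (nearestDist_le_dist y hii')
  have hpack := card_le_of_separated_of_dist_le s (y j) (by positivity) (by positivity) hR hr
  rw [finrank_euclideanSpace, Fintype.card_fin, hcard] at hpack
  have hq : (2 * (101 / 100 * nearestDist y j) / (nearestDist y j / (101 / 100)) + 1 : ℝ) = 2 * (101 / 100) ^ 2 + 1 := by
    field_simp
  rw [hq] at hpack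
  have : ((2 : ℝ) * (101 / 100) ^ 2 + 1) ^ 3 ≤ 29 := by norm_num
  exact hpack.trans this

/-- **Counting**: if every two-shell charge-free(1/100) site is good, then `N ≤ #good + 30·#charged` (a site that is not two-shell charge-free is
charged or a bond-neighbour of a charged site; bond degrees `≤ 29`). [folklore] -/
theorem card_le_good_add {N : ℕ} {y : Fin N → EuclideanSpace ℝ (Fin 3)} (hy : Function.Injective y)
    (hsep : ∀ a b : Fin N, a ≠ b → (7 : ℝ) / 10 ≤ dist (y a) (y b)) {good : Fin N → Prop}
    (hgood : ∀ i : Fin N, IsChargeFree (1 / 100 : ℝ) y i →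
      (∀ j : Fin N, (bondGraph (1 / 100 : ℝ) y).Adj i j → IsChargeFree (1 / 100 : ℝ) y j) → good i) :
    (N : ℝ) ≤ (Nat.card {i : Fin N // good i} : ℝ) + 30 * (charged (1 / 100) y : ℝ) := by
  classical
  set G := bondGraph (1 / 100 : ℝ) y with hG
  set TS : Finset (Fin N) := Finset.univ.filter fun i =>
    IsChargeFree (1 / 100 : ℝ) y i ∧ ∀ j : Fin N, G.Adj i j → IsChargeFree (1 / 100 : ℝ) y j with hTS
  set NTS : Finset (Fin N) := Finset.univ.filter fun i =>
    ¬ (IsChargeFree (1 / 100 : ℝ) y i ∧ ∀ j : Fin N, G.Adj i j → IsChargeFree (1 / 100 : ℝ) y j) with hNTS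
  set CH : Finset (Fin N) := Finset.univ.filter fun i => ¬ IsChargeFree (1 / 100 : ℝ) y i with hCH
  set B : Finset (Fin N) := Finset.univ.filter fun i => ∃ j : Fin N, G.Adj i j ∧ ¬ IsChargeFree (1 / 100 : ℝ) y j with hB
  set GD : Finset (Fin N) := Finset.univ.filter fun i => good i with hGD
  -- `N = #TS + #NTS`
  have hsplit : TS.card + NTS.card = N := by
    have h := Finset.card_filter_add_card_filter_not (s := (Finset.univ : Finset (Fin N)))
      (fun i : Fin N => IsChargeFree (1 / 100 : ℝ) y i ∧ ∀ j : Fin N, G.Adj i j → IsChargeFree (1 / 100 : ℝ) y j)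
    rwa [Finset.card_univ, Fintype.card_fin] at h
  -- `#TS ≤ #good`
  have h1 : TS.card ≤ GD.card :=
    Finset.card_le_card (Finset.monotone_filter_right _ fun i _ hi => hgood i hi.1 hi.2)
  have hGD' : (Nat.card {i : Fin N // good i} : ℝ) = GD.card := by
    rw [Nat.card_eq_fintype_card, Fintype.card_subtype]
  have hCH' : (charged (1 / 100) y : ℝ) = CH.card := by
    unfold charged
    rw [Nat.card_eq_fintype_card, Fintype.card_subtype]
  -- `#NTS ≤ #CH + #B`
  have h2 : NTS.card ≤ CH.card + B.card := by
    refine (Finset.card_le_card ?_).trans (Finset.card_union_le _ _)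
    intro i hi
    rw [Finset.mem_union]
    have hi' := (Finset.mem_filter.1 hi).2
    by_cases hc : IsChargeFree (1 / 100 : ℝ) y i
    · right
      refine Finset.mem_filter.2 ⟨Finset.mem_univ _, ?_⟩
      by_contra hne
      push Not at hne
      exact hi' ⟨hc, fun j hj => hne j hj⟩
    · left
      exact Finset.mem_filter.2 ⟨Finset.mem_univ _, hc⟩
  -- `#B ≤ 29·#CH`
  have h3 : (B.card : ℝ) ≤ 29 * CH.card := by
    have hsub : B ⊆ CH.biUnion fun j => Finset.univ.filter fun i : Fin N => G.Adj i j := by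
      intro i hi
      obtain ⟨j, hij, hj⟩ := (Finset.mem_filter.1 hi).2
      exact Finset.mem_biUnion.2 ⟨j, Finset.mem_filter.2 ⟨Finset.mem_univ _, hj⟩, Finset.mem_filter.2 ⟨Finset.mem_univ _, hij⟩⟩
    have hle := (Finset.card_le_card hsub).trans Finset.card_biUnion_le
    calc (B.card : ℝ) ≤ ((∑ j ∈ CH, (Finset.univ.filter fun i : Fin N => G.Adj i j).card : ℕ) : ℝ) := by exact_mod_cast hle
      _ = ∑ j ∈ CH, ((Finset.univ.filter fun i : Fin N => G.Adj i j).card : ℝ) := by push_cast; rfl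
      _ ≤ ∑ j ∈ CH, (29 : ℝ) := Finset.sum_le_sum fun j _ => by
          have h := card_adj_le hy hsep j
          rwa [Nat.card_eq_fintype_card, Fintype.card_subtype] at h
      _ = 29 * CH.card := by rw [Finset.sum_const, nsmul_eq_mul, mul_comm]
  have hsplit' : (N : ℝ) = TS.card + NTS.card := by exact_mod_cast hsplit.symm
  have h1' : (TS.card : ℝ) ≤ GD.card := by exact_mod_cast h1
  have h2' : (NTS.card : ℝ) ≤ CH.card + B.card := by exact_mod_cast h2
  rw [hGD', hCH']
  linarith

/-- **`ChargedEnergyGap ∧ KR2_shape ⟹ FDG`** with `κ' = C = κ/30` (`κ` the price of item 14231): `κ·#charged ≤ U − N·e⋆` and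
`N ≤ #good + 30·#charged`. [folklore] -/
theorem frustrationDensityGap_of_chargedEnergyGap_of_kr2Shape (hgap : ChargedEnergyGap)
    (h2 : ∀ (N : ℕ) (y : Fin N → EuclideanSpace ℝ (Fin 3)), Function.Injective y → (∀ a b : Fin N, a ≠ b → (7 : ℝ) / 10 ≤ dist (y a) (y b)) → ∀ i : Fin N, Literature.Geometry.DiscreteGeometry.IsChargeFree (1 / 100 : ℝ) y i → (∀ j : Fin N, (Literature.Geometry.DiscreteGeometry.bondGraph (1 / 100 : ℝ) y).Adj i j → Literature.Geometry.DiscreteGeometry.IsChargeFree (1 / 100 : ℝ) y j) → ∃ (η : ℝ) (A : EuclideanSpace ℝ (Fin 3) →ₗᵢ[ℝ] EuclideanSpace ℝ (Fin 3)), η < 1 / 20 ∧ ((∃ τ : ↥Literature.Geometry.DiscreteGeometry.fccKissingPattern → Fin N, (∀ u : ↥Literature.Geometry.DiscreteGeometry.fccKissingPattern, (Literature.Geometry.DiscreteGeometry.bondGraph (1 / 100 : ℝ) y).Adj i (τ u)) ∧ (∀ k : Fin N, (Literature.Geometry.DiscreteGeometry.bondGraph (1 / 100 : ℝ) y).Adj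 i k → ∃ u : ↥Literature.Geometry.DiscreteGeometry.fccKissingPattern, τ u = k) ∧ (∀ u : ↥Literature.Geometry.DiscreteGeometry.fccKissingPattern, ‖(y (τ u) - y i) - Literature.Geometry.DiscreteGeometry.nearestDist y i • A (u : EuclideanSpace ℝ (Fin 3))‖ ≤ η * Literature.Geometry.DiscreteGeometry.nearestDist y i)) ∨ (∃ τ : ↥Literature.Geometry.DiscreteGeometry.hcpKissingPattern → Fin N, (∀ u : ↥Literature.Geometry.DiscreteGeometry.hcpKissingPattern, (Literature.Geometry.DiscreteGeometry.bondGraph (1 / 100 : ℝ) y).Adj i (τ u)) ∧ (∀ k : Fin N, (Literature.Geometry.DiscreteGeometry.bondGraph (1 / 100 : ℝ) y).Adj i k → ∃ u : ↥Literature.Geometry.DiscreteGeometry.hcpKissingPattern, τ u = k) ∧ (∀ u : ↥Literature.Geometry.DiscreteGeometry.hcpKissingPattern, ‖(y (τ u) - y i) - Literature.Geometry.DiscreteGeometry.nearestDist y i • A (u : EuclideanSpace ℝ (Fin 3))‖ ≤ η * Literature.Geometry.DiscreteGeometry.nearestDist y i)))) :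
    ∃ κ : ℝ, 0 < κ ∧ ∃ C : ℝ, ∀ (N : ℕ) (y : Fin N → EuclideanSpace ℝ (Fin 3)), Function.Injective y → (∀ a b : Fin N, a ≠ b → (7 : ℝ) / 10 ≤ dist (y a) (y b)) → κ * N - C * (Nat.card {i : Fin N // ∃ (d η γ : ℝ) (A : EuclideanSpace ℝ (Fin 3) →ₗᵢ[ℝ] EuclideanSpace ℝ (Fin 3)), (∃ t : ↥Literature.Geometry.DiscreteGeometry.fccKissingPattern → EuclideanSpace ℝ (Fin 3), 0 < d ∧ 0 < γ ∧ η < 1 / 20 ∧ (∀ u : ↥Literature.Geometry.DiscreteGeometry.fccKissingPattern, t u ∈ (Set.range y) ∧ ‖(t u - (y i)) - d • A (u : EuclideanSpace ℝ (Fin 3))‖ ≤ η * d) ∧ (∀ s : EuclideanSpace ℝ (Fin 3), s ∈ (Set.range y) → s ≠ (y i) → d ≤ dist s (y i)) ∧ (∃ s : EuclideanSpace ℝ (Fin 3), s ∈ (Set.range y) ∧ s ≠ (y i) ∧ dist s (y i) ≤ d) ∧ (∀ s : EuclideanSpace ℝ (Fin 3), s ∈ (Set.range y) → s ≠ (y i)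 → dist s (y i) < 13 / 10 * d + γ → dist s (y i) ≤ 13 / 10 * d - γ ∧ s ∈ Set.range t)) ∨ (∃ t : ↥Literature.Geometry.DiscreteGeometry.hcpKissingPattern → EuclideanSpace ℝ (Fin 3), 0 < d ∧ 0 < γ ∧ η < 1 / 20 ∧ (∀ u : ↥Literature.Geometry.DiscreteGeometry.hcpKissingPattern, t u ∈ (Set.range y) ∧ ‖(t u - (y i)) - d • A (u : EuclideanSpace ℝ (Fin 3))‖ ≤ η * d) ∧ (∀ s : EuclideanSpace ℝ (Fin 3), s ∈ (Set.range y) → s ≠ (y i) → d ≤ dist s (y i)) ∧ (∃ s : EuclideanSpace ℝ (Fin 3), s ∈ (Set.range y) ∧ s ≠ (y i) ∧ dist s (y i) ≤ d) ∧ (∀ s : EuclideanSpace ℝ (Fin 3), s ∈ (Set.range y) → s ≠ (y i) → dist s (y i) < 13 / 10 * d + γ → dist s (y i) ≤ 13 / 10 * d - γ ∧ s ∈ Set.range t))} : ℝ) ≤ Literature.MathematicalPhysics.StatisticalMechanics.interactionEnergy Literature.MathematicalPhysics.StatisticalMechanics.lennardJones y - N * (⨅ Q : Literature.MathematicalPhysics.StatisticalMechanics.PeriodicConfiguration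 3, Q.energyPerParticle Literature.MathematicalPhysics.StatisticalMechanics.lennardJones) := by
  classical
  obtain ⟨κ, hκ, hprice⟩ := chargedEnergyGap_iff_price.1 hgap
  refine ⟨κ / 30, by positivity, κ / 30, fun N y hy hsep => ?_⟩
  have hp := hprice N y hy
  have hc := card_le_good_add hy hsep (robustGood_of_twoShell h2 N y hy hsep)
  have hκ' : (0 : ℝ) ≤ κ / 30 := by positivity
  have hc' := mul_le_mul_of_nonneg_left hc hκ'
  show _ ≤ interactionEnergy lennardJones y - (N : ℝ) * eStar
  nlinarith [hc', hp]

/-- **`AperiodicFrustratedLawGap` (crux of item 27623) BY NAME from `MuEquilibriumDoor ∧ ChargedEnergyGap ∧ KR2_shape`.** [folklore] -/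
theorem aperiodicFrustratedLawGap_of_chargedEnergyGap_of_kr2Shape
    (hDoor : Summit.AtomisticToContinuum.Crystallization.Theses.GrainCoreNetworkSplit.MuEquilibriumDoor) (hgap : ChargedEnergyGap)
    (h2 : ∀ (N : ℕ) (y : Fin N → EuclideanSpace ℝ (Fin 3)), Function.Injective y → (∀ a b : Fin N, a ≠ b → (7 : ℝ) / 10 ≤ dist (y a) (y b)) → ∀ i : Fin N, Literature.Geometry.DiscreteGeometry.IsChargeFree (1 / 100 : ℝ) y i → (∀ j : Fin N, (Literature.Geometry.DiscreteGeometry.bondGraph (1 / 100 : ℝ) y).Adj i j → Literature.Geometry.DiscreteGeometry.IsChargeFree (1 / 100 : ℝ) y j) → ∃ (η : ℝ) (A : EuclideanSpace ℝ (Fin 3) →ₗᵢ[ℝ] EuclideanSpace ℝ (Fin 3)), η < 1 / 20 ∧ ((∃ τ : ↥Literature.Geometry.DiscreteGeometry.fccKissingPattern → Fin N, (∀ u : ↥Literature.Geometry.DiscreteGeometry.fccKissingPattern, (Literature.Geometry.DiscreteGeometry.bondGraph (1 / 100 : ℝ) y).Adj i (τ u)) ∧ (∀ k : Fin N, (Literature.Geometry.DiscreteGeometry.bondGraph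 (1 / 100 : ℝ) y).Adj i k → ∃ u : ↥Literature.Geometry.DiscreteGeometry.fccKissingPattern, τ u = k) ∧ (∀ u : ↥Literature.Geometry.DiscreteGeometry.fccKissingPattern, ‖(y (τ u) - y i) - Literature.Geometry.DiscreteGeometry.nearestDist y i • A (u : EuclideanSpace ℝ (Fin 3))‖ ≤ η * Literature.Geometry.DiscreteGeometry.nearestDist y i)) ∨ (∃ τ : ↥Literature.Geometry.DiscreteGeometry.hcpKissingPattern → Fin N, (∀ u : ↥Literature.Geometry.DiscreteGeometry.hcpKissingPattern, (Literature.Geometry.DiscreteGeometry.bondGraph (1 / 100 : ℝ) y).Adj i (τ u)) ∧ (∀ k : Fin N, (Literature.Geometry.DiscreteGeometry.bondGraph (1 / 100 : ℝ) y).Adj i k → ∃ u : ↥Literature.Geometry.DiscreteGeometry.hcpKissingPattern, τ u = k) ∧ (∀ u : ↥Literature.Geometry.DiscreteGeometry.hcpKissingPattern, ‖(y (τ u) - y i) - Literature.Geometry.DiscreteGeometry.nearestDist y i • A (u : EuclideanSpace ℝ (Fin 3))‖ ≤ η * Literature.Geometry.DiscreteGeometry.nearestDist y i)))) :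
    Summit.AtomisticToContinuum.Crystallization.Theses.FrustratedLawDichotomy.AperiodicFrustratedLawGap :=
  aperiodicFrustratedLawGap_of_frustrationDensityGap hDoor (frustrationDensityGap_of_chargedEnergyGap_of_kr2Shape hgap h2)

/-- **The REGISTERED STUB `stub_aperiodicErgodicGap` of the crux skeleton (dd3251ad), verbatim, from `MuEquilibriumDoor ∧ ChargedEnergyGap ∧
KR2_shape`.** [folklore] -/
theorem aperiodicErgodicGap_of_chargedEnergyGap_of_kr2Shape
    (hDoor : Summit.AtomisticToContinuum.Crystallization.Theses.GrainCoreNetworkSplit.MuEquilibriumDoor) (hgap : ChargedEnergyGap)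
    (h2 : ∀ (N : ℕ) (y : Fin N → EuclideanSpace ℝ (Fin 3)), Function.Injective y → (∀ a b : Fin N, a ≠ b → (7 : ℝ) / 10 ≤ dist (y a) (y b)) → ∀ i : Fin N, Literature.Geometry.DiscreteGeometry.IsChargeFree (1 / 100 : ℝ) y i → (∀ j : Fin N, (Literature.Geometry.DiscreteGeometry.bondGraph (1 / 100 : ℝ) y).Adj i j → Literature.Geometry.DiscreteGeometry.IsChargeFree (1 / 100 : ℝ) y j) → ∃ (η : ℝ) (A : EuclideanSpace ℝ (Fin 3) →ₗᵢ[ℝ] EuclideanSpace ℝ (Fin 3)), η < 1 / 20 ∧ ((∃ τ : ↥Literature.Geometry.DiscreteGeometry.fccKissingPattern → Fin N, (∀ u : ↥Literature.Geometry.DiscreteGeometry.fccKissingPattern, (Literature.Geometry.DiscreteGeometry.bondGraph (1 / 100 : ℝ) y).Adj i (τ u)) ∧ (∀ k : Fin N, (Literature.Geometry.DiscreteGeometry.bondGraph (1 / 100 : ℝ) y).Adj i k → ∃ u : ↥Literature.Geometry.DiscreteGeometry.fccKissingPattern, τ u = k) ∧ (∀ u : ↥Literature.Geometry.DiscreteGeometry.fccKissingPattern,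 ‖(y (τ u) - y i) - Literature.Geometry.DiscreteGeometry.nearestDist y i • A (u : EuclideanSpace ℝ (Fin 3))‖ ≤ η * Literature.Geometry.DiscreteGeometry.nearestDist y i)) ∨ (∃ τ : ↥Literature.Geometry.DiscreteGeometry.hcpKissingPattern → Fin N, (∀ u : ↥Literature.Geometry.DiscreteGeometry.hcpKissingPattern, (Literature.Geometry.DiscreteGeometry.bondGraph (1 / 100 : ℝ) y).Adj i (τ u)) ∧ (∀ k : Fin N, (Literature.Geometry.DiscreteGeometry.bondGraph (1 / 100 : ℝ) y).Adj i k → ∃ u : ↥Literature.Geometry.DiscreteGeometry.hcpKissingPattern, τ u = k) ∧ (∀ u : ↥Literature.Geometry.DiscreteGeometry.hcpKissingPattern, ‖(y (τ u) - y i) - Literature.Geometry.DiscreteGeometry.nearestDist y i • A (u : EuclideanSpace ℝ (Fin 3))‖ ≤ η * Literature.Geometry.DiscreteGeometry.nearestDist y i)))) :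
    ∀ δ : ℝ, 0 < δ → ∀ P : MeasureTheory.Measure (MeasureTheory.Measure (EuclideanSpace ℝ (Fin 3))), let Gy : ℝ → (N : ℕ) → (Fin N → EuclideanSpace ℝ (Fin 3)) → Fin N → Prop := fun η N y j => let d : ℝ := sInf ((fun z => dist z (y (j : Fin N))) '' (Set.range (y) \ {(y (j : Fin N))})); let T : Set (EuclideanSpace ℝ (Fin 3)) := {z : EuclideanSpace ℝ (Fin 3) | z ∈ Set.range (y) ∧ z ≠ (y (j : Fin N)) ∧ dist z (y (j : Fin N)) < 13 / 10 * d}; ∃ A : EuclideanSpace ℝ (Fin 3) →ₗᵢ[ℝ] EuclideanSpace ℝ (Fin 3), (∃ e : ↥T ≃ ↥Literature.Geometry.DiscreteGeometry.fccKissingPattern, ∀ t : ↥T, dist (d⁻¹ • ((t : EuclideanSpace ℝ (Fin 3)) - (y (j : Fin N)))) (A ((e t : ↥Literature.Geometry.DiscreteGeometry.fccKissingPattern) : EuclideanSpace ℝ (Fin 3))) ≤ η) ∨ (∃ e : ↥T ≃ ↥Literature.Geometry.DiscreteGeometry.hcpKissingPattern, ∀ t : ↥T, dist (d⁻¹ •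 ((t : EuclideanSpace ℝ (Fin 3)) - (y (j : Fin N)))) (A ((e t : ↥Literature.Geometry.DiscreteGeometry.hcpKissingPattern) : EuclideanSpace ℝ (Fin 3))) ≤ η); let TexBall : (N : ℕ) → (Fin N → EuclideanSpace ℝ (Fin 3)) → Fin N → ℝ → ℝ → ℝ → ℝ → Prop := fun N y i R R₇ R₈ R₉ => (∀ a b : Fin N, a ≠ b → (7 : ℝ) / 10 ≤ dist (y a) (y b)) ∧ (∀ j : Fin N, dist (y j) (y i) ≤ R → ¬ Gy (1 / 20) N (y) j) ∧ (∀ j : Fin N, dist (y j) (y i) ≤ R → ¬ ((∀ j' : Fin N, dist (y j') (y j) ≤ R₇ → ¬ Gy (1 / 20) N (y) j') ∧ (∀ z : EuclideanSpace ℝ (Fin 3), dist z (y j) ≤ R₇ → ∃ k : Fin N, dist z (y k) ≤ 1) ∧ (∀ j' : Fin N, dist (y j') (y j) ≤ R₇ → (let d : ℝ := sInf ((fun z => dist z (y j')) '' (Set.range (y) \ {(y j')})); ∀ k : Fin N, y k ≠ y j' → dist (y k) (y j') < 27 / 20 * d → 5 ≤ Nat.card {m : Fin N // y m ≠ y j'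 ∧ dist (y m) (y j') < 27 / 20 * d ∧ y m ≠ y k ∧ dist (y m) (y k) < 27 / 20 * d})))) ∧ (∀ j : Fin N, dist (y j) (y i) ≤ R → ∃ k : Fin N, dist (y k) (y j) ≤ R₈ ∧ Gy (1 / 8) N (y) k) ∧ (∀ j : Fin N, dist (y j) (y i) ≤ R → ¬ ((∀ j' : Fin N, dist (y j') (y j) ≤ R₉ → ¬ Gy (1 / 20) N (y) j') ∧ (Nat.card {j' : Fin N // dist (y j') (y j) ≤ R₉ ∧ ¬ Gy (1 / 8) N (y) j'} : ℝ) ≤ 1 / 2 * (Nat.card {j' : Fin N // dist (y j') (y j) ≤ R₉} : ℝ) ∧ (∀ j' : Fin N, dist (y j') (y j) ≤ R₉ → ¬ Gy (1 / 8) N (y) j' → ¬ (let d : ℝ := sInf ((fun z => dist z (y j')) '' (Set.range (y) \ {(y j')})); ∀ k : Fin N, y k ≠ y j' → dist (y k) (y j') < 27 / 20 * d → 5 ≤ Nat.card {m : Fin N // y m ≠ y j' ∧ dist (y m) (y j') < 27 / 20 * d ∧ y m ≠ y k ∧ dist (y m) (y k) < 27 / 20 * d})))); let Appr : MeasureTheory.Measure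 (EuclideanSpace ℝ (Fin 3)) → ℝ → ℝ → ℝ → Prop := fun μ R₇ R₈ R₉ => ∀ q : EuclideanSpace ℝ (Fin 3), μ {q} ≠ 0 → ∀ R ε : ℝ, 0 < ε → ∃ (N : ℕ) (y : Fin N → EuclideanSpace ℝ (Fin 3)) (i : Fin N), TexBall N y i R R₇ R₈ R₉ ∧ (∀ p : EuclideanSpace ℝ (Fin 3), μ {p} ≠ 0 → dist p q ≤ R → ∃ k : Fin N, dist (y k - y i) (p - q) ≤ ε) ∧ (∀ k : Fin N, dist (y k) (y i) ≤ R → ∃ p : EuclideanSpace ℝ (Fin 3), μ {p} ≠ 0 ∧ dist (y k - y i) (p - q) ≤ ε); MeasureTheory.IsProbabilityMeasure P → (∀ᵐ μ ∂P, Literature.Probability.Process.IsRootedHardCore δ μ) → Literature.Probability.Process.IsPointStationaryLaw P → (∃ R₇ R₈ R₉ : ℝ, ∀ᵐ μ ∂P, Appr μ R₇ R₈ R₉) → (∀ᵐ μ ∂P, ∀ p : EuclideanSpace ℝ (Fin 3), μ {p} ≠ 0 → ∀ y : EuclideanSpace ℝ (Fin 3), (∀ q : EuclideanSpace ℝ (Fin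 3), μ {q} ≠ 0 → q ≠ p → y ≠ q) → ∑' q : {q : EuclideanSpace ℝ (Fin 3) // μ {q} ≠ 0 ∧ q ≠ p}, Literature.MathematicalPhysics.StatisticalMechanics.lennardJones (dist p (q : EuclideanSpace ℝ (Fin 3))) ≤ ∑' q : {q : EuclideanSpace ℝ (Fin 3) // μ {q} ≠ 0 ∧ q ≠ p}, Literature.MathematicalPhysics.StatisticalMechanics.lennardJones (dist y (q : EuclideanSpace ℝ (Fin 3)))) → P {μ : MeasureTheory.Measure (EuclideanSpace ℝ (Fin 3)) | ∃ Q : Literature.MathematicalPhysics.StatisticalMechanics.PeriodicConfiguration 3, ∃ t : EuclideanSpace ℝ (Fin 3), {p : EuclideanSpace ℝ (Fin 3) | μ {p} ≠ 0} = (fun s => s + t) '' Q.points} = 0 → (∀ A : Set (MeasureTheory.Measure (EuclideanSpace ℝ (Fin 3))), MeasurableSet A → (∀ μ : MeasureTheory.Measure (EuclideanSpace ℝ (Fin 3)), ∀ p : EuclideanSpace ℝ (Fin 3), μ {p} ≠ 0 → (μ ∈ A ↔ MeasureTheory.Measure.map (fun z : EuclideanSpace ℝ (Fin 3) => z - p)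 μ ∈ A)) → P A = 0 ∨ P Aᶜ = 0) → (⨅ Q : Literature.MathematicalPhysics.StatisticalMechanics.PeriodicConfiguration 3, Q.energyPerParticle Literature.MathematicalPhysics.StatisticalMechanics.lennardJones) < (∫ μ, Literature.MathematicalPhysics.StatisticalMechanics.rootEnergy Literature.MathematicalPhysics.StatisticalMechanics.lennardJones μ ∂P) :=
  aperiodicErgodicGap_of_frustrationDensityGap hDoor (frustrationDensityGap_of_chargedEnergyGap_of_kr2Shape hgap h2)

/-- **`NoFrustratedPeriodicMinimiser` (item 26654) from `ChargedEnergyGap ∧ KR2_shape`, DOOR-FREE.** [folklore] -/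
theorem noFrustratedPeriodicMinimiser_of_chargedEnergyGap_of_kr2Shape (hgap : ChargedEnergyGap)
    (h2 : ∀ (N : ℕ) (y : Fin N → EuclideanSpace ℝ (Fin 3)), Function.Injective y → (∀ a b : Fin N, a ≠ b → (7 : ℝ) / 10 ≤ dist (y a) (y b)) → ∀ i : Fin N, Literature.Geometry.DiscreteGeometry.IsChargeFree (1 / 100 : ℝ) y i → (∀ j : Fin N, (Literature.Geometry.DiscreteGeometry.bondGraph (1 / 100 : ℝ) y).Adj i j → Literature.Geometry.DiscreteGeometry.IsChargeFree (1 / 100 : ℝ) y j) → ∃ (η : ℝ) (A : EuclideanSpace ℝ (Fin 3) →ₗᵢ[ℝ] EuclideanSpace ℝ (Fin 3)), η < 1 / 20 ∧ ((∃ τ : ↥Literature.Geometry.DiscreteGeometry.fccKissingPattern → Fin N, (∀ u : ↥Literature.Geometry.DiscreteGeometry.fccKissingPattern, (Literature.Geometry.DiscreteGeometry.bondGraph (1 / 100 : ℝ) y).Adj i (τ u)) ∧ (∀ k : Fin N, (Literature.Geometry.DiscreteGeometry.bondGraph (1 / 100 : ℝ) y).Adj i k → ∃ u : ↥Literature.Geometry.DiscreteGeometry.fccKissingPattern,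 τ u = k) ∧ (∀ u : ↥Literature.Geometry.DiscreteGeometry.fccKissingPattern, ‖(y (τ u) - y i) - Literature.Geometry.DiscreteGeometry.nearestDist y i • A (u : EuclideanSpace ℝ (Fin 3))‖ ≤ η * Literature.Geometry.DiscreteGeometry.nearestDist y i)) ∨ (∃ τ : ↥Literature.Geometry.DiscreteGeometry.hcpKissingPattern → Fin N, (∀ u : ↥Literature.Geometry.DiscreteGeometry.hcpKissingPattern, (Literature.Geometry.DiscreteGeometry.bondGraph (1 / 100 : ℝ) y).Adj i (τ u)) ∧ (∀ k : Fin N, (Literature.Geometry.DiscreteGeometry.bondGraph (1 / 100 : ℝ) y).Adj i k → ∃ u : ↥Literature.Geometry.DiscreteGeometry.hcpKissingPattern, τ u = k) ∧ (∀ u : ↥Literature.Geometry.DiscreteGeometry.hcpKissingPattern, ‖(y (τ u) - y i) - Literature.Geometry.DiscreteGeometry.nearestDist y i • A (u : EuclideanSpace ℝ (Fin 3))‖ ≤ η * Literature.Geometry.DiscreteGeometry.nearestDist y i)))) :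
    Summit.AtomisticToContinuum.Crystallization.Theses.PeriodicChargeSplit.NoFrustratedPeriodicMinimiser :=
  noFrustratedPeriodicMinimiser_of_frustrationDensityGap (frustrationDensityGap_of_chargedEnergyGap_of_kr2Shape hgap h2)

end Summit.AtomisticToContinuum.Crystallization.Theorems.FrustratedLawDichotomyTwoShellRigidityDoor

end
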